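/-
Copyright (c) 2026 the pub-hodgecm-mathlib formalisation cell (harness21).  Prover seat hodgecm-mathlib-K2E3-p04 (g0), Track B ∕ K2-LIT
(build stream 29), h413 = `stmt-HodgeConjecture-24833`, line `K2_E3_EllipticInputs`, unit U4 «Keys» — DEAL `K2E3RankOneIntertwiningIntegral`, road I, brick I-2a
«THE INTERTWINING INTEGRAL ON THE SPHERICAL LINE».  2026-09-03.
-/
import Summits.HodgeConjecture.HodgeConjecture.Theorems.K2E3RankOneIntertwiningIntegralConvergence  -- ★ RUNG 3 (this seat, p855375): `exists_intertwiningIntegral_of_modulus`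
import Literature.NumberTheory.Automorphic.CMPrincipalSeriesSpherical                              -- ★ `rootDeltaChar_borel_eq_one_of_mem_isCompact`, `proj_mem_cmLocalIntegralLevel`; brings ★ `SmoothInductionSphericalLine`, ★ Iwasawa `exists_borel_mul_mem_cmLocalIntegralLevel`
import HarnessLib

/-!
# h413 ∕ Track B «K2-LIT», unit U4 «Keys», DEAL `K2E3RankOneIntertwiningIntegral`, road I brick I-2a: ON THE `K_v`-SPHERICAL LINE every `G`-map `i_G(χ) → i_G(χ')`
# (`χ, χ'` unramified) is EVALUATION AT `1`: `A f_K = (A f_K)(1) · f'_K`; in particular `J(w, χ) f_K = c_w(χ) · f'_K` with HARISH-CHANDRA's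
# `c_w(χ) = ∫_N f_K(w₀ n) dn`  [Casselman1995 §6.4, Thm. 3.3 of Casselman1980 «The unramified principal series»; Keys1984 §3–§4; Rogawski1990 §4.5 p. 45]

Cell `pub/hodgecm-mathlib`, crux H413 = `stmt-HodgeConjecture-24833` (lane `--supports … --as helper`), route HCCMUnconditional; dealer K2E3-plan (g1) («Road I files stay
`--supports 24833 --as helper`», 2026-09-03T23:02Z).  THEOREMS ONLY (0 def ∕ 0 instance ∕ 0 notation ∕ 0 sorry); ★-only imports.  Consumer: the closed form of `c_w(χ)`
(Macdonald's formula for `U(3)`: road I-3 ∕ II-2, K2E3-p05) turns `J(w⁻¹, wχ) J(w, χ) f_K = c_w(χ) c_{w}(wχ) f_K` into Keys' `γ(χ)` on the spherical line.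

THE MATHEMATICS.  `G ⊇ H, K` with `G = H · K` (Iwasawa), `σ, σ'` one-dimensional representations of `H`.  A `K`-fixed vector of `Ind_H^G σ'` is determined by its value at `1`
(★ `Representation.eq_of_toFun_one_eq`); a `G`-map `A` preserves `K`-fixed vectors; so if `f'₀ ∈ (Ind σ')^K` has `f'₀(1) = 1` then `A f = (A f)(1) · f'₀` for every `f ∈ (Ind σ)^K`
(§1 `apply_eq_toFun_one_smul`, generic).  At `G = U(Φ₃)(L⁺_v)`, `H = B`, `K = K_v = U(Φ₃)(𝒪_v)` (★ `cmLocalIntegralLevel`), `σ = χ δ_B^{1∕2}` with `χ` UNRAMIFIED (`χ(t) = 1` on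
`T ∩ K_v`): the spherical vector `f_K` (`f_K(b k) = χδ^{1∕2}(b)`, `f_K(1) = 1`) EXISTS (§2 `exists_sphericalVector`: ★ `exists_mem_fixedPoints_toFun_eq`, `δ_B^{1∕2} = 1` on `B ∩ K_v` ★,
`χ(proj b) = 1` ★ `proj_mem_cmLocalIntegralLevel`), and §1 gives §2 **`intertwiningMap_sphericalVector_eq_smul`** (`A f_K = (A f_K)(1) • f'_K` for ALL `G`-maps, both characters
unramified) and §3 **`exists_intertwiningIntegral_sphericalVector_eq_smul`**: for `‖χ₁‖ = ‖·‖^σ`, `σ > 0`, `v` non-split, the intertwining integral `J` of ★ RUNG 3 satisfies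
**`J f_K = (∫_N f_K(w₀ n) dμ(n)) • f'_K`** — the `c`-function AS AN INTEGRAL ([Casselman1995, §6.4]: «`T_w φ_K = c_w(χ) φ'_K`»).

HONEST LABEL.  HC_CM is proved only modulo the 7 printed citations (2 remaining named inputs: hLiu418 = `stmt-HodgeConjecture-24832`, h413 = `stmt-HodgeConjecture-24833`) until
rung 0 closes; count-neutral.  The VALUE of `c_w(χ)` (Macdonald ∕ Gindikin–Karpelevich for the quasi-split `U(3)`, [Rogawski1990, §4.5], [Keys1984, §4]) is NOT computed here.

## References
* [Casselman1995] W. Casselman, *Introduction to the theory of admissible representations of `p`-adic reductive groups* (1995), §6.4 pp. 62–64, Thm. 3.2.4.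
* [Keys1984] D. Keys, *Principal series representations of special unitary groups over local fields*, Compositio Math. 51 (1984), §3–§4.
* [Rogawski1990] J. D. Rogawski, *Automorphic Representations of Unitary Groups in Three Variables* (1990), §4.5 p. 45 («`i_G(χ)^K` is one-dimensional by Iwasawa»), §12.2 p. 173.
* [CartierCorvallis1979] P. Cartier, *Representations of `p`-adic groups: a survey*, Proc. Symp. Pure Math. 33 (1979), §III.3, §IV.1.
-/

set_option autoImplicit false
-- the mandated namespace repeats the single-problem summit's segment (`HodgeConjecture.HodgeConjecture`)
set_option linter.dupNamespace false

noncomputable section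

open NumberField IsDedekindDomain MeasureTheory
open scoped Matrix NNReal ENNReal

open Literature.NumberTheory Literature.NumberTheory.Automorphic Literature.NumberTheory.Automorphic.UnitaryGroup

namespace Summit.HodgeConjecture.HodgeConjecture.Cruxes.H413.K2E3IntertwiningIntegralSphericalLine

universe u

/-! ## §1 Generic: a `G`-map between induced representations of characters is «evaluation at `1`» on `K`-fixed vectors -/

section Generic

variable {G : Type u} [Group G] [TopologicalSpace G] [SeparatelyContinuousMul G] {H K : Subgroup G}
  (σ σ' : Representation ℂ ↥H ℂ)

/-- **`A f = (A f)(1) • f'₀`** for a `G`-map `A : Ind_H^G σ → Ind_H^G σ'` (`σ, σ'` characters), `f ∈ (Ind σ)^K`, and `f'₀ ∈ (Ind σ')^K` with `f'₀(1) = 1`, when `G = H · K`: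
`A f` is `K`-fixed (a `G`-map commutes with `K`), so is `(A f)(1) • f'₀`, both take the value `(A f)(1)` at `1`, and a `K`-fixed vector is determined by its value at `1`
(★ `Representation.eq_of_toFun_one_eq`). [cite: CartierCorvallis1979, §III.3, §IV.1] [cite: Rogawski1990, §4.5 p. 45] [cite: Casselman1995, §6.4 p. 63] -/
theorem apply_eq_toFun_one_smul (hGK : ∀ g : G, ∃ h : ↥H, ∃ κ ∈ K, g = (h : G) * κ)
    (A : (Representation.smoothIndRep H σ).IntertwiningMap (Representation.smoothIndRep H σ'))
    {f : Representation.SmoothInd H σ} (hf : f ∈ (Representation.smoothIndRep H σ).fixedPoints K)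
    {f₀' : Representation.SmoothInd H σ'} (hf₀' : f₀' ∈ (Representation.smoothIndRep H σ').fixedPoints K) (h1 : f₀'.toFun 1 = 1) :
    A f = (A f).toFun 1 • f₀' := by
  have hAf : A f ∈ (Representation.smoothIndRep H σ').fixedPoints K := by
    rw [Representation.mem_fixedPoints] at hf ⊢
    intro κ hκ
    rw [← Representation.IntertwiningMap.isIntertwining, hf κ hκ]
  have hsm : (A f).toFun 1 • f₀' ∈ (Representation.smoothIndRep H σ').fixedPoints K := Submodule.smul_mem _ _ hf₀'
  refine Representation.eq_of_toFun_one_eq σ' hGK hAf hsm ?_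
  rw [Representation.SmoothInd.toFun_smul, Pi.smul_apply, h1, smul_eq_mul, mul_one]

end Generic

/-! ## §2 `U(Φ₃)(L⁺_v)`: the spherical vector of an unramified `i_G(χ)` and the evaluation formula for every `G`-map -/

section CM

variable (L : Type) [Field L] [NumberField L] [IsCMField L] (v : HeightOneSpectrum (𝓞 ↥(maximalRealSubfield L)))

set_option synthInstance.maxHeartbeats 400000 in
set_option maxHeartbeats 4000000 in
-- statement over the `SmoothInd` carrier of ★ `cmPrincipalSeries` (class of ★ `CMPrincipalSeriesSpherical`)
/-- **THE SPHERICAL VECTOR of an UNRAMIFIED principal series of `U(Φ₃)(L⁺_v)`** (every finite `v`): if `χ(t) = 1` for every diagonal `t ∈ K_v = U(Φ₃)(𝒪_v)` (★ `cmLocalIntegralLevel`),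
there is a `K_v`-FIXED `f_K` in the carrier of ★ `cmPrincipalSeries L 3 v χ` with `f_K(1) = 1` (and `f_K(b k) = χ(proj b) δ_B^{1∕2}(b)`): ★ `exists_mem_fixedPoints_toFun_eq` with the Iwasawa
decomposition `G = B · K_v` (★ `exists_borel_mul_mem_cmLocalIntegralLevel`) — the inducing character is trivial on `B ∩ K_v` (`δ_B^{1∕2} = 1` there ★ `rootDeltaChar_borel_eq_one_of_mem_isCompact`,
`proj (B ∩ K_v) ⊆ K_v` ★ `proj_mem_cmLocalIntegralLevel`). [cite: Rogawski1990, §4.5 p. 45] [cite: CartierCorvallis1979, §IV.1] -/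
theorem exists_sphericalVector (χ : ↥(torusU (conjLocal L (IsCMField.complexConj L) v) (cmLocalForm L 3 v)) →* ℂˣ)
    (hχ : ∀ t : ↥(torusU (conjLocal L (IsCMField.complexConj L) v) (cmLocalForm L 3 v)), (t : ↥(unitaryGroupOfForm (conjLocal L (IsCMField.complexConj L) v) (cmLocalForm L 3 v))) ∈ cmLocalIntegralLevel L 3 (Matrix.of fun i j : Fin 3 => if i.val + j.val + 1 = 3 then (1 : L) else 0) v → χ t = 1) :
    haveI := locallyCompactSpace_cmBorelU L 3 v
    ∃ fK : Representation.SmoothInd (cmBorelTriple L 3 v).P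
        (Representation.twist
          (((Representation.trivial ℂ ↥(torusU (conjLocal L (IsCMField.complexConj L) v) (cmLocalForm L 3 v)) ℂ).twist
            (χ)).comp (cmBorelTriple L 3 v).proj) (rootDeltaChar (cmBorelTriple L 3 v).P)),
      fK ∈ (Representation.smoothIndRep (cmBorelTriple L 3 v).P _).fixedPoints (cmLocalIntegralLevel L 3 (Matrix.of fun i j : Fin 3 => if i.val + j.val + 1 = 3 then (1 : L) else 0) v) ∧ fK.toFun 1 = 1 := by
  haveI := locallyCompactSpace_cmBorelU L 3 v
  have hK := isCompact_isOpen_cmLocalIntegralLevel L 3 (Matrix.of fun i j : Fin 3 => if i.val + j.val + 1 = 3 then (1 : L) else 0) v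
  have hGK : ∀ g : ↥(unitaryGroupOfForm (conjLocal L (IsCMField.complexConj L) v) (cmLocalForm L 3 v)), ∃ h : ↥(cmBorelTriple L 3 v).P, ∃ κ : ↥(unitaryGroupOfForm (conjLocal L (IsCMField.complexConj L) v) (cmLocalForm L 3 v)), κ ∈ cmLocalIntegralLevel L 3 (Matrix.of fun i j : Fin 3 => if i.val + j.val + 1 = 3 then (1 : L) else 0) v ∧ g = (h : ↥(unitaryGroupOfForm (conjLocal L (IsCMField.complexConj L) v) (cmLocalForm L 3 v))) * κ := fun g => by
    obtain ⟨b, k, hk, hg⟩ := exists_borel_mul_mem_cmLocalIntegralLevel L 3 v g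
    exact ⟨b, k, hk, hg⟩
  have hw : (1 : ℂ) ∈ (Representation.twist
      (((Representation.trivial ℂ ↥(torusU (conjLocal L (IsCMField.complexConj L) v) (cmLocalForm L 3 v)) ℂ).twist χ).comp (cmBorelTriple L 3 v).proj)
      (rootDeltaChar (cmBorelTriple L 3 v).P)).fixedPoints ((cmLocalIntegralLevel L 3 (Matrix.of fun i j : Fin 3 => if i.val + j.val + 1 = 3 then (1 : L) else 0) v).subgroupOf (cmBorelTriple L 3 v).P) := by
    rw [Representation.mem_fixedPoints]
    intro b hb
    have hb' : ((b : ↥(cmBorelTriple L 3 v).P) : ↥(unitaryGroupOfForm (conjLocal L (IsCMField.complexConj L) v) (cmLocalForm L 3 v))) ∈ cmLocalIntegralLevel L 3 (Matrix.of fun i j : Fin 3 => if i.val + j.val + 1 = 3 then (1 : L) else 0) v := Subgroup.mem_subgroupOf.1 hb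
    rw [Representation.twist_apply,
      rootDeltaChar_borel_eq_one_of_mem_isCompact (conjLocal L (IsCMField.complexConj L) v) (cmLocalForm L 3 v) (cmLocalForm_eq_over L 3 v) hK.1 b hb',
      Units.val_one, one_smul, MonoidHom.comp_apply, Representation.twist_apply, hχ _ (proj_mem_cmLocalIntegralLevel L 3 v b hb'),
      Units.val_one, one_smul]
    rfl
  obtain ⟨fK, hfK, h1, -⟩ := Representation.exists_mem_fixedPoints_toFun_eq _ hK.2 hGK hw
  exact ⟨fK, hfK, h1⟩

set_option synthInstance.maxHeartbeats 400000 in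
set_option maxHeartbeats 4000000 in
-- statement over two `SmoothInd` carriers of ★ `cmPrincipalSeries` (class of ★ `CMPrincipalSeriesSpherical`)
/-- **ON THE SPHERICAL LINE A `G`-MAP IS EVALUATION AT `1`**: `G = U(Φ₃)(L⁺_v)`, `χ, χ'` characters of the diagonal torus, `f_K ∈ i_G(χ)^{K_v}`, `f'_K ∈ i_G(χ')^{K_v}` with `f'_K(1) = 1`
(§2 `exists_sphericalVector` supplies them for unramified characters); then EVERY `G`-map `A : i_G(χ) → i_G(χ')` (★ `cmPrincipalSeries`) has **`A f_K = (A f_K)(1) • f'_K`**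
(§1 with the Iwasawa decomposition `G = B · K_v` ★). [cite: Casselman1995, §6.4 p. 63] [cite: Rogawski1990, §4.5 p. 45] [cite: Keys1984, §3] -/
theorem intertwiningMap_sphericalVector_eq_smul (χ χ' : ↥(torusU (conjLocal L (IsCMField.complexConj L) v) (cmLocalForm L 3 v)) →* ℂˣ)
    (A : (cmPrincipalSeries L 3 v χ).IntertwiningMap (cmPrincipalSeries L 3 v χ'))
    (fK : haveI := locallyCompactSpace_cmBorelU L 3 v
      Representation.SmoothInd (cmBorelTriple L 3 v).P
        (Representation.twist
          (((Representation.trivial ℂ ↥(torusU (conjLocal L (IsCMField.complexConj L) v) (cmLocalForm L 3 v)) ℂ).twist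
            (χ)).comp (cmBorelTriple L 3 v).proj) (rootDeltaChar (cmBorelTriple L 3 v).P)))
    (hfK : haveI := locallyCompactSpace_cmBorelU L 3 v
      fK ∈ (Representation.smoothIndRep (cmBorelTriple L 3 v).P _).fixedPoints (cmLocalIntegralLevel L 3 (Matrix.of fun i j : Fin 3 => if i.val + j.val + 1 = 3 then (1 : L) else 0) v))
    (fK' : haveI := locallyCompactSpace_cmBorelU L 3 v
      Representation.SmoothInd (cmBorelTriple L 3 v).P
        (Representation.twist
          (((Representation.trivial ℂ ↥(torusU (conjLocal L (IsCMField.complexConj L) v) (cmLocalForm L 3 v)) ℂ).twist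
            (χ')).comp (cmBorelTriple L 3 v).proj) (rootDeltaChar (cmBorelTriple L 3 v).P)))
    (hfK' : haveI := locallyCompactSpace_cmBorelU L 3 v
      fK' ∈ (Representation.smoothIndRep (cmBorelTriple L 3 v).P _).fixedPoints (cmLocalIntegralLevel L 3 (Matrix.of fun i j : Fin 3 => if i.val + j.val + 1 = 3 then (1 : L) else 0) v))
    (h1 : fK'.toFun 1 = 1) :
    A fK = (A fK).toFun 1 • fK' := by
  haveI := locallyCompactSpace_cmBorelU L 3 v
  have hGK : ∀ g : ↥(unitaryGroupOfForm (conjLocal L (IsCMField.complexConj L) v) (cmLocalForm L 3 v)), ∃ h : ↥(cmBorelTriple L 3 v).P, ∃ κ : ↥(unitaryGroupOfForm (conjLocal L (IsCMField.complexConj L) v) (cmLocalForm L 3 v)), κ ∈ cmLocalIntegralLevel L 3 (Matrix.of fun i j : Fin 3 => if i.val + j.val + 1 = 3 then (1 : L) else 0) v ∧ g = (h : ↥(unitaryGroupOfForm (conjLocal L (IsCMField.complexConj L) v) (cmLocalForm L 3 v))) * κ := fun g => by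
    obtain ⟨b, k, hk, hg⟩ := exists_borel_mul_mem_cmLocalIntegralLevel L 3 v g
    exact ⟨b, k, hk, hg⟩
  -- ★ `cmPrincipalSeries` ∕ ★ `principalSeries` ∕ ★ `normalizedInd` ARE ★ `smoothIndRep` (definitional)
  dsimp only [UnitaryGroup.cmPrincipalSeries, UnitaryGroup.principalSeries, Representation.normalizedInd] at A
  exact apply_eq_toFun_one_smul _ _ hGK A hfK hfK' h1

/-! ## §3 The intertwining integral on the spherical vector: `J(w, χ) f_K = c_w(χ) • f'_K`, `c_w(χ) = ∫_N f_K(w₀ n) dμ` -/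

set_option synthInstance.maxHeartbeats 400000 in
set_option maxHeartbeats 8000000 in
-- statement∕proof over two `SmoothInd` carriers of ★ `cmPrincipalSeries` (class of ★ RUNG 3 `exists_intertwiningIntegral_of_modulus`)
/-- **`J(w, χ) f_K = c_w(χ) · f'_K` WITH `c_w(χ) = ∫_N f_K(w₀ n) dμ(n)` (Harish-Chandra's `c`-function as the intertwining integral on the spherical vector).**  `G = U(Φ₃)(L⁺_v)`, `v` NON-SPLIT,
`w₀` of matrix `Φ₃`, `μ` a Haar measure of `N(L⁺_v)`, `χ = (χ₁, χ₂)` continuous with `‖χ₁‖ = ‖·‖_E^σ`, `σ > 0`; `f_K ∈ i_G(χ)^{K_v}`, `f'_K ∈ i_G(wχ)^{K_v}` with `f'_K(1) = 1` (for `χ`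
unramified both exist, §2).  Then the intertwining integral `J` of ★ `exists_intertwiningIntegral_of_modulus` (`J ≠ 0`, `(J f)(g) = ∫_N f(w₀ n g) dμ`) satisfies
**`J f_K = (∫_N f_K(w₀ n) dμ(n)) • f'_K`** (§2 at `A = J`, and `(J f_K)(1) = ∫_N f_K(w₀ n · 1) dμ`).  [Casselman1995, §6.4: «`T_w(φ_K) = c_w(χ) φ_{K,wχ}`»; the closed form of `c_w`
(Macdonald) is road I-3 ∕ II-2.] [cite: Casselman1995, §6.4 pp. 62–64] [cite: Keys1984, §3–§4] [cite: Rogawski1990, §4.5 p. 45; §12.2 p. 173] -/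
theorem exists_intertwiningIntegral_sphericalVector_eq_smul
    (hns : ∀ w : PlacesOver L v, IsCMField.complexConj L • w.1 = w.1)
    (χ₁ : (LocalRing L v)ˣ →* ℂˣ) (χ₂ : ↥(normOneUnits (conjLocal L (IsCMField.complexConj L) v)) →* ℂˣ)
    (h₁ : Continuous fun x => ((χ₁ x : ℂˣ) : ℂ)) (h₂ : Continuous fun x => ((χ₂ x : ℂˣ) : ℂ)) {σ : ℝ} (hσ : 0 < σ)
    (hχ₁ : ∀ x : (LocalRing L v)ˣ, ‖((χ₁ x : ℂˣ) : ℂ)‖ = ((unitModulusChar (LocalRing L v) x : ℝ≥0) : ℝ) ^ σ)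
    (w₀ : ↥(unitaryGroupOfForm (conjLocal L (IsCMField.complexConj L) v) (cmLocalForm L 3 v))) (hw₀ : Units.val (w₀ : GL (Fin 3) (LocalRing L v)) = cmLocalForm L 3 v)
    [MeasurableSpace ↥(cmBorelTriple L 3 v).N] [BorelSpace ↥(cmBorelTriple L 3 v).N] (μ : Measure ↥(cmBorelTriple L 3 v).N) [μ.IsHaarMeasure]
    (fK : haveI := locallyCompactSpace_cmBorelU L 3 v
      Representation.SmoothInd (cmBorelTriple L 3 v).P
        (Representation.twist
          (((Representation.trivial ℂ ↥(torusU (conjLocal L (IsCMField.complexConj L) v) (cmLocalForm L 3 v)) ℂ).twist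
            (cmTorusCharPair L v χ₁ χ₂)).comp (cmBorelTriple L 3 v).proj) (rootDeltaChar (cmBorelTriple L 3 v).P)))
    (hfK : haveI := locallyCompactSpace_cmBorelU L 3 v
      fK ∈ (Representation.smoothIndRep (cmBorelTriple L 3 v).P _).fixedPoints (cmLocalIntegralLevel L 3 (Matrix.of fun i j : Fin 3 => if i.val + j.val + 1 = 3 then (1 : L) else 0) v))
    (fK' : haveI := locallyCompactSpace_cmBorelU L 3 v
      Representation.SmoothInd (cmBorelTriple L 3 v).P
        (Representation.twist
          (((Representation.trivial ℂ ↥(torusU (conjLocal L (IsCMField.complexConj L) v) (cmLocalForm L 3 v)) ℂ).twist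
            (cmTorusCharPair L v (conjInvChar (conjLocal L (IsCMField.complexConj L) v) χ₁) χ₂)).comp (cmBorelTriple L 3 v).proj) (rootDeltaChar (cmBorelTriple L 3 v).P)))
    (hfK' : haveI := locallyCompactSpace_cmBorelU L 3 v
      fK' ∈ (Representation.smoothIndRep (cmBorelTriple L 3 v).P _).fixedPoints (cmLocalIntegralLevel L 3 (Matrix.of fun i j : Fin 3 => if i.val + j.val + 1 = 3 then (1 : L) else 0) v))
    (h1 : fK'.toFun 1 = 1) :
    ∃ J : (cmPrincipalSeries L 3 v (cmTorusCharPair L v χ₁ χ₂)).IntertwiningMap (cmPrincipalSeries L 3 v (cmTorusCharPair L v (conjInvChar (conjLocal L (IsCMField.complexConj L) v) χ₁) χ₂)),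
      J ≠ 0 ∧
      (∀ (f : haveI := locallyCompactSpace_cmBorelU L 3 v
          Representation.SmoothInd (cmBorelTriple L 3 v).P
        (Representation.twist
          (((Representation.trivial ℂ ↥(torusU (conjLocal L (IsCMField.complexConj L) v) (cmLocalForm L 3 v)) ℂ).twist
            (cmTorusCharPair L v χ₁ χ₂)).comp (cmBorelTriple L 3 v).proj) (rootDeltaChar (cmBorelTriple L 3 v).P)))
        (g : ↥(unitaryGroupOfForm (conjLocal L (IsCMField.complexConj L) v) (cmLocalForm L 3 v))),
        (J f).toFun g = ∫ n : ↥(cmBorelTriple L 3 v).N, f.toFun (w₀ * (n : ↥(unitaryGroupOfForm (conjLocal L (IsCMField.complexConj L) v) (cmLocalForm L 3 v))) * g) ∂μ) ∧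
      J fK = (∫ n : ↥(cmBorelTriple L 3 v).N, fK.toFun (w₀ * (n : ↥(unitaryGroupOfForm (conjLocal L (IsCMField.complexConj L) v) (cmLocalForm L 3 v)))) ∂μ) • fK' := by
  obtain ⟨J, hJ, hJint⟩ := K2E3RankOneIntertwiningIntegralConvergence.exists_intertwiningIntegral_of_modulus L v hns χ₁ χ₂ h₁ h₂ hσ hχ₁ w₀ hw₀ μ
  refine ⟨J, hJ, hJint, ?_⟩
  have h := intertwiningMap_sphericalVector_eq_smul L v _ _ J fK hfK fK' hfK' h1
  rw [hJint fK 1] at h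
  simp_rw [mul_one] at h
  exact h

end CM

end Summit.HodgeConjecture.HodgeConjecture.Cruxes.H413.K2E3IntertwiningIntegralSphericalLine

end
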